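import Literature.MeasureTheory.Group.InvariantQuotientNormalized
import HarnessLib

/-!
# Naturality of the quotient measure under isomorphisms of topological groups: covolumes and
# orbital integrals are transported along `e : G ≃* G'`
(Deitmar–Echterhoff, *Principles of Harmonic Analysis* (2014), Thm. 1.5.3; Gelbart, *Automorphic
forms on adele groups* (1975), §10, p. 155)

Topic `MeasureTheory/Group`; namespace `Literature.MeasureTheory.Group`. Definitions
(`cosetCongr`, `cosetCongrEquiv`, `cosetCongrHomeomorph`, `subgroupCongrHomeomorph`: the maps of
coset spaces and of subgroups induced by a group isomorphism) and theorems; no named fact, no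
instance.

The quotient measure `ν/ρ = quotientMeasure H ρ ν` of `InvariantQuotientExistence` (the invariant
Radon measure on `G ⧸ H` with Weil constant one, built by Riesz representation from Haar-type measures
`ν` on `G`, `ρ` on `H`) is canonical, hence natural: for a homeomorphic group isomorphism
`e : G ≃* G'` and closed subgroups `H ≤ G`, `H' ≤ G'` with `e⁻¹(H') = H`,

  `(cosetCongr e)_* (ν/ρ) = (e_* ν)/((e|_H)_* ρ)`    (`map_cosetCongr_quotientMeasure`),

so that total masses (covolumes, `quotientMeasure_univ_eq_of_mulEquiv`), integrals
(`lintegral_quotientMeasure_eq_of_mulEquiv`) and orbital integrals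
`∫_{G/G_γ} F(x γ x⁻¹)` (`lintegral_descConj_quotientMeasure_eq_of_mulEquiv`) correspond under `e`.
Proof: the image measure is `G'`-invariant and finite on compact sets, hence `c •` the quotient
measure with `c` its unfolding constant (`eq_unfoldingConstant_smul_quotientMeasure`,
`InvariantQuotientNormalized`), and `c = 1` because fibre integrals are natural
(`fiberLIntegral_cosetCongr`) and the quotient measure unfolds with constant one
(`lintegral_fiberLIntegral_quotientMeasure`).

Why this is here. In the comparison of the trace formulas for `D^×` and `GL(2)` (Gelbart (1975),
§10, (10.14) against (10.15), "Tamagawa measures being taken on both sides", p. 155) the elliptic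
terms are indexed on both sides by the quadratic extensions `E/K` embeddable in `D`, and the
volume factors `meas(Z_𝔸 B_F \ B_𝔸)` and orbital integrals over `B_𝔸 \ G_𝔸` refer to the tori
`B_𝔸 = E_𝔸ˣ` realised once inside `D_𝔸ˣ` (as `C_{D_𝔸ˣ}(γ)`, `QuaternionUnitsTraceNormalized`) and once
inside `GL₂(𝔸)`; identifying the two volume factors is exactly the naturality proved here, applied
to the isomorphism of the two realisations of `E_𝔸ˣ`. A brick of the inline (D-0026) decomposition
of `Literature.NumberTheory.Automorphic.strong_multiplicity_one_quaternionUnits` (Gelbart Thm. 10.5).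

## References

* A. Deitmar, S. Echterhoff, *Principles of Harmonic Analysis*, 2nd ed. (2014), Thm. 1.5.3
  [DeitmarEchterhoff2014].
* S. Gelbart, *Automorphic forms on adele groups*, Ann. of Math. Studies 83 (1975), §10, p. 155
  [Gelbart1975].
-/

noncomputable section

open _root_.MeasureTheory _root_.MeasureTheory.Measure _root_.Topology Set Filter Function
open scoped ENNReal NNReal Pointwise

attribute [-instance] Quotient.instMeasurableSpace QuotientGroup.measurableSpace

namespace Literature.MeasureTheory.Group

/-! ### The map of coset spaces induced by an isomorphism -/

section CosetCongr

variable {G G' : Type*} [Group G] [Group G'] (e : G ≃* G') (H : Subgroup G) (H' : Subgroup G')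
  (hHH' : ∀ g, e g ∈ H' ↔ g ∈ H)

include hHH' in
/-- Compatibility of `e` with the coset relations. [folklore] -/
theorem leftRel_map_of_forall_mem_iff (a b : G) (hab : QuotientGroup.leftRel H a b) :
    QuotientGroup.leftRel H' (e a) (e b) := by
  rw [QuotientGroup.leftRel_apply] at hab ⊢
  rw [← map_inv, ← map_mul]
  exact (hHH' _).2 hab

/-- **The map of coset spaces induced by a group isomorphism**: for `e : G ≃* G'` and subgroups
`H ≤ G`, `H' ≤ G'` with `e⁻¹(H') = H`, `cosetCongr e H H' (g H) = e(g) H'` (`Quotient.map'`).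
[folklore] -/
def cosetCongr : G ⧸ H → G' ⧸ H' :=
  Quotient.map' e (leftRel_map_of_forall_mem_iff e H H' hHH')

/-- `cosetCongr e (gH) = e(g) H'` (definitional). [folklore] -/
@[simp]
theorem cosetCongr_mk (g : G) :
    cosetCongr e H H' hHH' (QuotientGroup.mk g) = QuotientGroup.mk (e g) := rfl

include hHH' in
/-- The symmetric compatibility: `e⁻¹ g' ∈ H ↔ g' ∈ H'`. [folklore] -/
theorem forall_symm_mem_iff : ∀ g', e.symm g' ∈ H ↔ g' ∈ H' := fun g' => by
  rw [← hHH' (e.symm g'), MulEquiv.apply_symm_apply]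

/-- `cosetCongr e.symm` is a left inverse of `cosetCongr e`. [folklore] -/
theorem cosetCongr_symm_apply (x : G ⧸ H) :
    cosetCongr e.symm H' H (forall_symm_mem_iff e H H' hHH') (cosetCongr e H H' hHH' x) = x := by
  induction x using QuotientGroup.induction_on with
  | H g => rw [cosetCongr_mk, cosetCongr_mk, MulEquiv.symm_apply_apply]

/-- `cosetCongr e.symm` is a right inverse of `cosetCongr e`. [folklore] -/
theorem cosetCongr_apply_symm (y : G' ⧸ H') :
    cosetCongr e H H' hHH' (cosetCongr e.symm H' H (forall_symm_mem_iff e H H' hHH') y) = y := by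
  induction y using QuotientGroup.induction_on with
  | H g => rw [cosetCongr_mk, cosetCongr_mk, MulEquiv.apply_symm_apply]

/-- **Equivariance**: `cosetCongr e (g • x) = e(g) • cosetCongr e x`. [folklore] -/
theorem cosetCongr_smul (g : G) (x : G ⧸ H) :
    cosetCongr e H H' hHH' (g • x) = e g • cosetCongr e H H' hHH' x := by
  induction x using QuotientGroup.induction_on with
  | H a => rw [MulAction.Quotient.smul_mk, smul_eq_mul, cosetCongr_mk, cosetCongr_mk,
      MulAction.Quotient.smul_mk, smul_eq_mul, map_mul]

/-- `cosetCongr` as a bijection `G ⧸ H ≃ G' ⧸ H'`. [folklore] -/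
def cosetCongrEquiv : G ⧸ H ≃ G' ⧸ H' where
  toFun := cosetCongr e H H' hHH'
  invFun := cosetCongr e.symm H' H (forall_symm_mem_iff e H H' hHH')
  left_inv := cosetCongr_symm_apply e H H' hHH'
  right_inv := cosetCongr_apply_symm e H H' hHH'

variable [TopologicalSpace G] [TopologicalSpace G']

/-- `cosetCongr e` is continuous when `e` is. [folklore] -/
theorem continuous_cosetCongr (he : Continuous e) : Continuous (cosetCongr e H H' hHH') :=
  Continuous.quotient_map' he _

/-- **`cosetCongr` as a homeomorphism `G ⧸ H ≃ₜ G' ⧸ H'`** when `e` is a homeomorphism. [folklore] -/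
def cosetCongrHomeomorph (he : Continuous e) (hes : Continuous e.symm) : G ⧸ H ≃ₜ G' ⧸ H' where
  toEquiv := cosetCongrEquiv e H H' hHH'
  continuous_toFun := continuous_cosetCongr e H H' hHH' he
  continuous_invFun := continuous_cosetCongr e.symm H' H (forall_symm_mem_iff e H H' hHH') hes

/-- The underlying map of `cosetCongrHomeomorph` (definitional). [folklore] -/
@[simp]
theorem coe_cosetCongrHomeomorph (he : Continuous e) (hes : Continuous e.symm) :
    ⇑(cosetCongrHomeomorph e H H' hHH' he hes) = cosetCongr e H H' hHH' := rfl

/-- **The restriction `H ≃ₜ H'` of `e`** (as a homeomorphism of the subgroup types). [folklore] -/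
def subgroupCongrHomeomorph (he : Continuous e) (hes : Continuous e.symm) : H ≃ₜ H' where
  toFun := fun h => ⟨e h, (hHH' h).2 h.2⟩
  invFun := fun h' => ⟨e.symm h', (forall_symm_mem_iff e H H' hHH' h').2 h'.2⟩
  left_inv := fun h => Subtype.ext (e.symm_apply_apply h)
  right_inv := fun h' => Subtype.ext (e.apply_symm_apply h')
  continuous_toFun := (he.comp continuous_subtype_val).subtype_mk _
  continuous_invFun := (hes.comp continuous_subtype_val).subtype_mk _

/-- The underlying map of `subgroupCongrHomeomorph` (definitional). [folklore] -/
@[simp]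
theorem coe_subgroupCongrHomeomorph_apply (he : Continuous e) (hes : Continuous e.symm) (h : H) :
    ((subgroupCongrHomeomorph e H H' hHH' he hes h : H') : G') = e h := rfl

end CosetCongr

/-! ### Naturality of the quotient measure -/

section Transport

variable {G G' : Type*} [Group G] [Group G'] [TopologicalSpace G] [TopologicalSpace G']
  [IsTopologicalGroup G] [IsTopologicalGroup G'] [LocallyCompactSpace G] [LocallyCompactSpace G']
  [SecondCountableTopology G] [SecondCountableTopology G'] [T2Space G] [T2Space G']
  [MeasurableSpace G] [BorelSpace G] [MeasurableSpace G'] [BorelSpace G']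
  (e : G ≃* G') (he : Continuous e) (hes : Continuous e.symm)
  (H : Subgroup G) [hH : IsClosed (H : Set G)] (H' : Subgroup G') [hH' : IsClosed (H' : Set G')]
  (hHH' : ∀ g, e g ∈ H' ↔ g ∈ H)
  [MeasurableSpace (G ⧸ H)] [BorelSpace (G ⧸ H)] [MeasurableSpace (G' ⧸ H')] [BorelSpace (G' ⧸ H')]
  (ρ : Measure H) [ρ.IsMulLeftInvariant] [IsFiniteMeasureOnCompacts ρ] [ρ.IsOpenPosMeasure]
  [ρ.IsInvInvariant] [SFinite ρ]
  (ρ' : Measure H') [ρ'.IsMulLeftInvariant] [IsFiniteMeasureOnCompacts ρ'] [ρ'.IsOpenPosMeasure]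
  [ρ'.IsInvInvariant] [SFinite ρ']
  (ν : Measure G) [IsHaarMeasure ν] [ν.IsMulRightInvariant]
  (ν' : Measure G') [IsHaarMeasure ν'] [ν'.IsMulRightInvariant]

omit [LocallyCompactSpace G] [LocallyCompactSpace G']
  [SecondCountableTopology G] [SecondCountableTopology G'] [T2Space G] [T2Space G'] hH hH'
  [MeasurableSpace (G ⧸ H)] [BorelSpace (G ⧸ H)] [MeasurableSpace (G' ⧸ H')] [BorelSpace (G' ⧸ H')]
  [IsFiniteMeasureOnCompacts ρ] [ρ.IsOpenPosMeasure] [ρ.IsInvInvariant] [SFinite ρ]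
  [IsFiniteMeasureOnCompacts ρ'] [ρ'.IsOpenPosMeasure] [ρ'.IsInvInvariant] [SFinite ρ'] in
/-- **Fibre integrals are natural**: with `ρ' = (e|_H)_* ρ`, for `F : G' → [0, ∞]` and `g ∈ G`,
`∫⁻_{H'} F(e(g) h') dρ'(h') = ∫⁻_H F(e(g h)) dρ(h)`, i.e.
`fiberLIntegral H' ρ' F ∘ cosetCongr e = fiberLIntegral H ρ (F ∘ e)`. [folklore] -/
theorem fiberLIntegral_cosetCongr
    (hρ' : ρ' = Measure.map (subgroupCongrHomeomorph e H H' hHH' he hes) ρ) (F : G' → ℝ≥0∞)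
    (x : G ⧸ H) :
    fiberLIntegral H' ρ' F (cosetCongr e H H' hHH' x) = fiberLIntegral H ρ (F ∘ e) x := by
  induction x using QuotientGroup.induction_on with
  | H g =>
    rw [cosetCongr_mk, fiberLIntegral_mk, fiberLIntegral_mk, hρ',
      ← Homeomorph.toMeasurableEquiv_coe, lintegral_map_equiv]
    refine lintegral_congr fun h => ?_
    simp only [Homeomorph.toMeasurableEquiv_coe, coe_subgroupCongrHomeomorph_apply,
      Function.comp_apply, map_mul]

include he in
omit [LocallyCompactSpace G'] [SecondCountableTopology G'] [T2Space G'] hH' [SFinite ρ] in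
/-- The image of the quotient measure under `cosetCongr e` is `G'`-invariant. [folklore] -/
theorem smulInvariantMeasure_map_cosetCongr :
    SMulInvariantMeasure G' (G' ⧸ H')
      (Measure.map (cosetCongr e H H' hHH') (quotientMeasure H ρ hH ν)) := by
  refine ⟨fun g' S hS => ?_⟩
  have hm : Measurable (cosetCongr e H H' hHH') := (continuous_cosetCongr e H H' hHH' he).measurable
  rw [Measure.map_apply hm hS, Measure.map_apply hm (hS.preimage (measurable_const_smul g'))]
  have h1 : cosetCongr e H H' hHH' ⁻¹' ((fun x => g' • x) ⁻¹' S) =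
      (fun x => e.symm g' • x) ⁻¹' (cosetCongr e H H' hHH' ⁻¹' S) := by
    ext x
    simp only [Set.mem_preimage, cosetCongr_smul, MulEquiv.apply_symm_apply]
  rw [h1]
  exact SMulInvariantMeasure.measure_preimage_smul (e.symm g') (hS.preimage hm)

/-- **Naturality of the quotient measure under isomorphisms of topological groups** (the
quotient measure of Deitmar–Echterhoff, Thm. 1.5.3, is canonical): for a homeomorphic group
isomorphism `e : G ≃* G'` with `e⁻¹(H') = H`, Haar-type measures `ρ` on `H`, `ν` on `G` and their
images `ρ' = (e|_H)_* ρ`, `ν' = e_* ν`,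
`(cosetCongr e)_* (quotientMeasure H ρ ν) = quotientMeasure H' ρ' ν'`. Proof: the image measure
is `G'`-invariant and finite on compact sets, so it is `c •` the quotient measure with `c` its
unfolding constant (`eq_unfoldingConstant_smul_quotientMeasure`); and `c = 1` because its lift is
`ν'`: for `f ∈ C_c(G')`, `∫_{G'/H'} ∫_{H'} f = ∫_{G/H} ∫_H (f ∘ e) = ∫_G f ∘ e dν = ∫_{G'} f dν'`.
[cite: DeitmarEchterhoff2014, Thm. 1.5.3] -/
theorem map_cosetCongr_quotientMeasure
    (hρ' : ρ' = Measure.map (subgroupCongrHomeomorph e H H' hHH' he hes) ρ)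
    (hν' : ν' = Measure.map e ν) :
    Measure.map (cosetCongr e H H' hHH') (quotientMeasure H ρ hH ν) =
      quotientMeasure H' ρ' hH' ν' := by
  set Φ : G ⧸ H ≃ₜ G' ⧸ H' := cosetCongrHomeomorph e H H' hHH' he hes with hΦ
  set μ' : Measure (G' ⧸ H') := Measure.map (cosetCongr e H H' hHH') (quotientMeasure H ρ hH ν)
    with hμ'
  have hμ'Φ : μ' = Measure.map Φ (quotientMeasure H ρ hH ν) := rfl
  haveI : SMulInvariantMeasure G' (G' ⧸ H') μ' :=
    smulInvariantMeasure_map_cosetCongr e he H H' hHH' ρ ν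
  haveI : IsFiniteMeasureOnCompacts μ' := by
    rw [hμ'Φ]; exact IsFiniteMeasureOnCompacts.map _ Φ
  -- the unfolding constant of `μ'` with respect to `ρ'`, `ν'` is `1`
  have key : ∀ g : G' → ℝ, Continuous g → HasCompactSupport g → 0 ≤ g →
      ∫ x, g x ∂liftMeasure H' ρ' μ' = ∫ x, g x ∂ν' := by
    intro g hg hgs hg0
    have hgm : Measurable fun a => ENNReal.ofReal (g a) := ENNReal.measurable_ofReal.comp hg.measurable
    set e' : G ≃ᵐ G' := (Homeomorph.mk e.toEquiv he hes).toMeasurableEquiv with he'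
    rw [integral_eq_lintegral_of_nonneg_ae (Eventually.of_forall fun x => hg0 x)
        hg.aestronglyMeasurable,
      integral_eq_lintegral_of_nonneg_ae (Eventually.of_forall fun x => hg0 x)
        hg.aestronglyMeasurable,
      lintegral_liftMeasure H' ρ' μ' hgm, hμ'Φ, ← Homeomorph.toMeasurableEquiv_coe,
      lintegral_map_equiv]
    congr 1
    have h1 : ∀ x, fiberLIntegral H' ρ' (fun a => ENNReal.ofReal (g a)) (Φ.toMeasurableEquiv x) =
        fiberLIntegral H ρ ((fun a => ENNReal.ofReal (g a)) ∘ e) x := fun x =>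
      fiberLIntegral_cosetCongr e he hes H H' hHH' ρ ρ' hρ' _ x
    simp_rw [h1]
    rw [lintegral_fiberLIntegral_quotientMeasure H ρ ν (hgm.comp he.measurable), hν',
      show (e : G → G') = e' from rfl, lintegral_map_equiv]
    rfl
  have hc : unfoldingConstant H' ρ' μ' ν' = 1 := by
    obtain ⟨g, hgs, hg0, hg1⟩ := exists_continuous_nonneg_pos (1 : G')
    have hgi : ∫ x, g x ∂ν' ≠ 0 :=
      (g.continuous.integral_pos_of_hasCompactSupport_nonneg_nonzero hgs hg0 hg1).ne'
    unfold unfoldingConstant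
    apply NNReal.coe_injective
    rw [haarScalarFactor_eq_integral_div_of_continuous_nonneg_pos _ ν' ⟨hgs, hg0, hg1⟩,
      key g g.continuous hgs hg0, NNReal.coe_one, div_self hgi]
  have h := eq_unfoldingConstant_smul_quotientMeasure H' ρ' ν' μ'
  rw [hc, one_smul] at h
  exact h

/-- **Total masses agree**: `(quotientMeasure H' ρ' ν')(G' ⧸ H') = (quotientMeasure H ρ ν)(G ⧸ H)`
— covolumes are invariant under isomorphisms of topological groups. [folklore] -/
theorem quotientMeasure_univ_eq_of_mulEquiv
    (hρ' : ρ' = Measure.map (subgroupCongrHomeomorph e H H' hHH' he hes) ρ)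
    (hν' : ν' = Measure.map e ν) :
    quotientMeasure H' ρ' hH' ν' Set.univ = quotientMeasure H ρ hH ν Set.univ := by
  rw [← map_cosetCongr_quotientMeasure e he hes H H' hHH' ρ ρ' ν ν' hρ' hν',
    Measure.map_apply (continuous_cosetCongr e H H' hHH' he).measurable MeasurableSet.univ,
    Set.preimage_univ]

/-- **Integrals against the quotient measures correspond**:
`∫⁻_{G'/H'} F d(ν'/ρ') = ∫⁻_{G/H} F ∘ cosetCongr e d(ν/ρ)` for every `F : G' ⧸ H' → [0, ∞]`.
[folklore] -/
theorem lintegral_quotientMeasure_eq_of_mulEquiv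
    (hρ' : ρ' = Measure.map (subgroupCongrHomeomorph e H H' hHH' he hes) ρ)
    (hν' : ν' = Measure.map e ν) (F : G' ⧸ H' → ℝ≥0∞) :
    ∫⁻ y, F y ∂quotientMeasure H' ρ' hH' ν' =
      ∫⁻ x, F (cosetCongr e H H' hHH' x) ∂quotientMeasure H ρ hH ν := by
  rw [← map_cosetCongr_quotientMeasure e he hes H H' hHH' ρ ρ' ν ν' hρ' hν',
    ← coe_cosetCongrHomeomorph e H H' hHH' he hes, ← Homeomorph.toMeasurableEquiv_coe,
    lintegral_map_equiv]

/-- **Orbital integrals correspond**: if `G₀ ≤ G` centralises `γ` and `G₀' = e(G₀)` (so that it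
centralises `e γ`), then for `F : G' → [0, ∞]`,
`∫⁻_{G'/G₀'} F(y (e γ) y⁻¹) d(ν'/ρ') = ∫⁻_{G/G₀} F(e(x γ x⁻¹)) d(ν/ρ)`. [folklore] -/
theorem lintegral_descConj_quotientMeasure_eq_of_mulEquiv
    (hρ' : ρ' = Measure.map (subgroupCongrHomeomorph e H H' hHH' he hes) ρ)
    (hν' : ν' = Measure.map e ν) {γ : G} (hHγ : ∀ g ∈ H, g * γ = γ * g)
    (hH'γ : ∀ g ∈ H', g * e γ = e γ * g) (F : G' → ℝ≥0∞) :
    ∫⁻ y, descConj (e γ) H' hH'γ F y ∂quotientMeasure H' ρ' hH' ν' =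
      ∫⁻ x, descConj γ H hHγ (F ∘ e) x ∂quotientMeasure H ρ hH ν := by
  rw [lintegral_quotientMeasure_eq_of_mulEquiv e he hes H H' hHH' ρ ρ' ν ν' hρ' hν']
  refine lintegral_congr fun x => ?_
  induction x using QuotientGroup.induction_on with
  | H g => simp only [cosetCongr_mk, descConj_mk, Function.comp_apply, map_mul, map_inv]

end Transport

end Literature.MeasureTheory.Group
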